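import Literature.MathematicalPhysics.QuantumFieldTheory.Balaban1983to89.T4PairResponseChart
import Literature.MathematicalPhysics.QuantumFieldTheory.Balaban1983to89.T4FlatExteriorInvariance

/-!
# `Balaban1983to89.T4PairResponseWindow` — the pair response UP TO EXTERIOR-ONLY WINDOW FACTORS: restrictions that do
# not read the fibre cancel in both conditional laws (audit cell `pub-balaban`, T⁴ lane, node O3.E)

HONEST FRAMING.  Audit cell `pub-balaban`, unit `b2b-balaban-pv16` (SURGE NODE PROVER #16, gen 12), self-proposed
continuation row **T4-O3.E-NE1′-TEL-INS-WINFAC\*** (third row of the seat; `HOME/t4/T4-DAG.md` §8 Q24(a)).  This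
module is BOOKKEEPING on the cell's OWN typed objects: it types NO sentence of CMP 109/116/122, proves NO estimate of
Bałaban's, and is NOT progress on any Clay-level statement.  Every declaration is [folklore]; no sentence of the audited
papers is used as a hypothesis; all sizes are binders.

CITATION HEADER (LOCATIONS only; nothing newly quoted as a hypothesis).  [Balaban1989LargeFieldI] = CMP 122:175–202:
(0.3)–(0.4) p. 176 («a large field expression is replaced by the corresponding small field expression in such a way,
that integrals of the densities are unchanged»; the decomposition `Z = Z′ ∪ Z″`), p. 177 («in (0.3), (0.5) we take the
denominators equal not the integrals of the whole densities ρ(Z″, V), but to the integrals of some parts of these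
densities … determined by small field effective actions only»), (1.75) (pv04's locus for the cancellation lever: «The
restriction introduced by this function is on the field V_k⌈_{Z∩Λᶜ} only.»), (1.100)–(1.102) p. 201.  These are
LOCATIONS read as prose by the seat (`paper:balaban1989-cmp122-large-field-i` p0002/p0003; the displayed formulas
(0.3), (1.100) are NOT legible in the held OCR) — the module's statements do not depend on them.

THE QUESTION (GAPS G-pv16g12-2 (P-a) = Q-ins-WIN; record `t4/T4-EST-O3Ei1.md` §4i).  ROUTE (P) of
`T4CondMeanChannelInsert` (the PAIR RESPONSE: the two conditional laws of one term as the endpoints of one exponential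
family in the law at a fixed exterior) carries the regime caveat (WIN): the two windows must AGREE on the fibre,
`χ₂(V←y) = χ₁(V←y)` for all `y` (first conjunct of `pairDom`).  In a term of (0.3) the integrated factor `ρ(Z′∪Z″,·)`
and the inserted expression `ρ(Z″,·)` carry DIFFERENT restrictions (large-field on `Z′` for the one, small-field for the
other), so (WIN) as typed fails whenever those restrictions are evaluated at different values — EVEN IF they do not read
the integrated variables at all.  But a density factor that is constant along the fibre CANCELS in the conditional law
(pv04, `T4FlatExteriorInvariance.condLaw_fibreConst_mul`).  So the honest regime condition of route (P) is weaker than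
(WIN): only the FIBRE-READING parts of the two windows must agree.

WHAT IS PROVED (all [folklore]; `T4CondMeanChannelInsert` / `T4PairResponseChart` / `T4FlatExteriorInvariance` /
`T4DressedR` BY NAME, nothing re-proved or modified).
§1 EXTERIOR-ONLY FACTORS: `condMean_fibreConst_mul` (a factor constant along the fibre through `V` and positive at `V`
   cancels in EVERY conditional mean — `condLaw_fibreConst_mul` by name); `fibreIntegral_fibreIndep_mul`,
   `mem_liveSet_fibreIndep_mul` (a nonnegative fibre-independent factor pulls out of the fibre integral —
   `T4DressedR.fibreIntegral_mul_of_fibreIndep` by name — so `e·w` is live at `V` iff `e V ≠ 0` and `w` is);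
   `fibreIndep_mul`, `fibreIndep_prod`, `fibreIndep_const` (product windows split as exterior-only part × fibre-reading
   part).
§2 TRANSFER `condMeanGap_of_fibreIndep_mul`: a per-exterior two-law conditional-mean bound for the STRIPPED pair
   `(old′, ins′)` on the live set of `e₁·old′` gives `CondMeanGap s (e₂·ins′) (e₁·old′) g ε` for fibre-independent
   `e₁ ≥ 0` and `e₂ > 0` on that live set (`condMeanGap_of_fibreIndep_mul'`: from `CondMeanGap s ins′ old′ g ε`; `condMeanGap_const_mul`: constant factors /
   normalisations, the non-vacuous simplest instance).
§3 ROUTE (P) UP TO EXTERIOR-ONLY WINDOW FACTORS: `abs_condMean_linDensity_pair_le_of_mem_pairDom` (the body of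
   `condMeanGap_linDensity_of_pairVariance`, LOCALISED to one exterior); `condMeanGap_linDensity_of_pairVariance_factor`:
   for `old = A₁·(ω·e^{h₁})`, `ins = A₂·(ω·e^{h₂})` with a COMMON measurable fibre-reading window `ω ≥ 0`, bounded
   stripped laws, FIBRE-INDEPENDENT factors `A₁ ≥ 0`, `A₂ > 0` on the old live set, and
   `liveSet s old ⊆ pairDom s ω ω h₁ h₂ B S σ τ` (whose (WIN) conjunct is now TRIVIAL):
   `CondMeanGap s ins old (linDensity t S a (fibreReading s B)) (|t|·(|S|·A·(σ·τ)))`;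
   `condMeanGap_linDensity_of_pairCharts_factor` (the chart form, `T4PairResponseChart.PairChartAt s ω ω …` at every
   old-live exterior, `ε = |t|·(|T|·A·(b·L/λ))`, real inserts); `abs_termDefect_le_of_pairVariance_factor` (the increment
   bound, `T4CondMeanChannelInsert.condMeanGap_of_pairChannel` + `T4ObservableTelescope.abs_termDefect_le_of_condMeanGap`).

HONEST SCOPE / CAVEATS.  (i) The regime caveat of route (P) becomes (WIN-FAC): the two windows factor as
`χᵢ = Aᵢ·ω` with `Aᵢ` FIBRE-INDEPENDENT (`T4DressedR.FibreIndep s`) and a COMMON fibre-reading part `ω`.  WHICH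
plaquette / bond factors of Bałaban's restrictions `χ_k`, `χ″_k`, `ζ` read a given fibre `s` — i.e. for which terms and
fibres (WIN-FAC) holds (plausibly: fibres at distance ≥ 1 from `Z′` and from the `ζ`-interpolation neighbourhood of
(1.100)) — is the `T4DressedR` census / Q-ins-WIN XREAD question and stays OPEN; nothing printed is asserted.  (ii) The
stripped laws `ω·e^{hᵢ}` must be bounded (`≤ C`) — a binder (for indicator windows and bounded-above exponents it is the
same bound).  (iii) (PVAR)/(CHART)/(EXT)/(HESS)/gradient bounds exactly as in `T4PairResponseChart`; (W1) untouched.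
(iv) One-writer: pv04's `T4FlatExteriorInvariance` and pv28's modules are imported BY NAME and not modified.
-/

noncomputable section

open _root_.MeasureTheory
open Function (updateFinset)
open scoped BigOperators InnerProductSpace ENNReal

namespace Literature.MathematicalPhysics.QuantumFieldTheory.Balaban1983to89.T4PairResponseWindow

open Literature.Probability.Distributions (coordGradient)
open B15.BasicStep T4DressedR T4DressingDefect T4CoReadMoment T4FirstOrderSize T4TiltModulus T4CondLawRelative
  T4ObservableTelescope T4CondMeanChannel T4CovarianceResponse T4CubePoincare T4CubeChartTransport T4CondMeanChannelInsert
  T4PairResponseChart T4FlatExteriorInvariance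

section Factors

variable {P : Params} {j : ℕ} {G : Type*} [GaugeGroup G] [MeasurableSpace G] [HaarData G]
variable [DecidableEq (PBond P j)]

/-! ## §1  Exterior-only factors -/

/-- **A FACTOR CONSTANT ALONG THE FIBRE CANCELS IN EVERY CONDITIONAL MEAN.**  For a density factor `e` with
`e(V←y) = e V` for all `y` and `0 < e V`: `E^{e·w}_s[g | V_out] = E^{w}_s[g | V_out]` — pv04's
`T4FlatExteriorInvariance.condLaw_fibreConst_mul` BY NAME. [folklore] -/
theorem condMean_fibreConst_mul (s : Finset (PBond P j)) {e w : Density P j G} {V : GaugeField P j G}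
    (he : ∀ y : s → G, e (updateFinset V s y) = e V) (hV : 0 < e V) (g : Density P j G) :
    condMean s (e * w) g V = condMean s w g V := by
  unfold condMean
  rw [condLaw_fibreConst_mul s he hV]

/-- A nonnegative fibre-independent factor pulls out of the fibre integral (`T4DressedR.fibreIntegral_mul_of_fibreIndep`
BY NAME, factor written on the left). [folklore] -/
theorem fibreIntegral_fibreIndep_mul (s : Finset (PBond P j)) {e w : Density P j G} (hw : Measurable w)
    (he : FibreIndep s e) (he0 : ∀ V, 0 ≤ e V) (V : GaugeField P j G) :
    fibreIntegral s (e * w) V = e V * fibreIntegral s w V := by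
  have h : e * w = fun U => w U * e U := funext fun U => mul_comm _ _
  rw [h]
  exact fibreIntegral_mul_of_fibreIndep s hw he he0 V

/-- `e·w` is live at `V` iff `e V ≠ 0` and `w` is live at `V` (nonnegative fibre-independent `e`). [folklore] -/
theorem mem_liveSet_fibreIndep_mul (s : Finset (PBond P j)) {e w : Density P j G} (hw : Measurable w)
    (he : FibreIndep s e) (he0 : ∀ V, 0 ≤ e V) {V : GaugeField P j G} :
    V ∈ liveSet s (e * w) ↔ e V ≠ 0 ∧ V ∈ liveSet s w := by
  rw [mem_liveSet, mem_liveSet, fibreIntegral_fibreIndep_mul s hw he he0 V, mul_ne_zero_iff]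

omit [GaugeGroup G] [MeasurableSpace G] [HaarData G] in
/-- Fibre-independence is closed under products. [folklore] -/
theorem fibreIndep_mul {s : Finset (PBond P j)} {e₁ e₂ : Density P j G} (h₁ : FibreIndep s e₁)
    (h₂ : FibreIndep s e₂) : FibreIndep s (e₁ * e₂) := fun x y => by
  rw [Pi.mul_apply, Pi.mul_apply, h₁ x y, h₂ x y]

omit [GaugeGroup G] [MeasurableSpace G] [HaarData G] in
/-- Constants are fibre-independent. [folklore] -/
theorem fibreIndep_const (s : Finset (PBond P j)) (c : ℝ) : FibreIndep s (fun _ : GaugeField P j G => c) :=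
  fun _ _ => rfl

omit [GaugeGroup G] [MeasurableSpace G] [HaarData G] in
/-- A finite product of fibre-independent factors is fibre-independent: a PRODUCT WINDOW `∏_{p ∈ T} u p` over
plaquettes / bonds none of which reads the fibre `s` is an exterior-only factor (the MODEL form of «restrictions on
plaquettes not touching the fibre»). [folklore] -/
theorem fibreIndep_prod {ι : Type*} (s : Finset (PBond P j)) (T : Finset ι) {u : ι → Density P j G}
    (hu : ∀ p ∈ T, FibreIndep s (u p)) : FibreIndep s (∏ p ∈ T, u p) := by
  classical
  induction T using Finset.induction_on with
  | empty => rw [Finset.prod_empty]; exact fibreIndep_const s 1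
  | insert p T hp ih =>
    rw [Finset.prod_insert hp]
    exact fibreIndep_mul (hu p (Finset.mem_insert_self p T))
      (ih fun q hq => hu q (Finset.mem_insert_of_mem hq))

/-! ## §2  Transfer of `CondMeanGap` along exterior-only factors -/

/-- **TRANSFER.**  A per-exterior two-law bound for the STRIPPED pair `(old′, ins′)` on the live set of `e₁·old′`
gives `CondMeanGap s (e₂·ins′) (e₁·old′) g ε`, for fibre-independent factors `e₁ ≥ 0` (then `e₁ V > 0` wherever
`e₁·old′` is live) and `e₂ > 0` on that live set: both factors cancel in the conditional means. [folklore] -/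
theorem condMeanGap_of_fibreIndep_mul {s : Finset (PBond P j)} {old' ins' e₁ e₂ : Density P j G}
    (hold' : Measurable old') (he₁ : FibreIndep s e₁) (he₁0 : ∀ V, 0 ≤ e₁ V) (he₂ : FibreIndep s e₂)
    (he₂pos : ∀ V ∈ liveSet s (e₁ * old'), 0 < e₂ V) {g : Density P j G} {ε : ℝ}
    (h : ∀ V ∈ liveSet s (e₁ * old'), fibreIntegral s old' V ≠ 0 →
      |condMean s old' g V - condMean s ins' g V| ≤ ε) :
    CondMeanGap s (e₂ * ins') (e₁ * old') g ε := by
  intro V hne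
  have hV : V ∈ liveSet s (e₁ * old') := hne
  obtain ⟨he₁V, hne'⟩ := (mem_liveSet_fibreIndep_mul s hold' he₁ he₁0).1 hV
  have hpos₁ : 0 < e₁ V := lt_of_le_of_ne (he₁0 V) (Ne.symm he₁V)
  rw [condMean_fibreConst_mul s (he₁ V) hpos₁, condMean_fibreConst_mul s (he₂ V) (he₂pos V hV)]
  exact h V hV hne'

/-- The same from a `CondMeanGap` of the stripped pair (which bounds the gap on the possibly LARGER live set of
`old′`). [folklore] -/
theorem condMeanGap_of_fibreIndep_mul' {s : Finset (PBond P j)} {old' ins' e₁ e₂ : Density P j G}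
    (hold' : Measurable old') (he₁ : FibreIndep s e₁) (he₁0 : ∀ V, 0 ≤ e₁ V) (he₂ : FibreIndep s e₂)
    (he₂pos : ∀ V ∈ liveSet s (e₁ * old'), 0 < e₂ V) {g : Density P j G} {ε : ℝ}
    (h : CondMeanGap s ins' old' g ε) : CondMeanGap s (e₂ * ins') (e₁ * old') g ε :=
  condMeanGap_of_fibreIndep_mul hold' he₁ he₁0 he₂ he₂pos fun V _ hne' => h V hne'

/-- The simplest instance (non-vacuity of the transfer): CONSTANT factors — e.g. different normalisations of the two
laws — never enter a `CondMeanGap` (`c₁ ≥ 0`, `c₂ > 0`). [folklore] -/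
theorem condMeanGap_const_mul {s : Finset (PBond P j)} {old' ins' : Density P j G} (hold' : Measurable old')
    {c₁ c₂ : ℝ} (hc₁ : 0 ≤ c₁) (hc₂ : 0 < c₂) {g : Density P j G} {ε : ℝ} (h : CondMeanGap s ins' old' g ε) :
    CondMeanGap s (fun U => c₂ * ins' U) (fun U => c₁ * old' U) g ε :=
  condMeanGap_of_fibreIndep_mul' (e₁ := fun _ => c₁) (e₂ := fun _ => c₂) hold' (fibreIndep_const s c₁)
    (fun _ => hc₁) (fibreIndep_const s c₂) (fun _ _ => hc₂) h

end Factors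

/-! ## §3  Route (P) up to exterior-only window factors -/

section RouteP

variable {P : Params} {j : ℕ} {G : Type*} [GaugeGroup G] [MeasurableSpace G] [HaarData G]
variable [DecidableEq (PBond P j)]
variable {E : Type*} [NormedAddCommGroup E] [InnerProductSpace ℝ E]
variable {β : Type*}

/-- **THE BODY OF (P4), LOCALISED TO ONE EXTERIOR.**  For Gibbs laws `old = χ₁e^{h₁}`, `ins = χ₂e^{h₂}` (measurable
data, `0 ≤ χ₁`, both `≤ C`), strongly measurable bounded bond inserts, `σ, τ ≥ 0`, an old-live exterior
`V ∈ pairDom s χ₁ χ₂ h₁ h₂ B S σ τ`: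
`|E^{old}_s[linDensity t S a (fibreReading s B) | V_out] − E^{ins}_s[… | V_out]| ≤ |t|·(|S|·A·(σ·τ))` —
`T4CondMeanChannelInsert.norm_condMean_pair_sub_le_of_varianceBound` + `abs_condMean_linDensity_pair_le` (the proof of
`condMeanGap_linDensity_of_pairVariance`, at one `V`). [folklore] -/
theorem abs_condMean_linDensity_pair_le_of_mem_pairDom [CompleteSpace E] (s : Finset (PBond P j))
    {χ₁ χ₂ h₁ h₂ : Density P j G} (hχm : Measurable χ₁) (hh₁ : Measurable h₁) (hh₂ : Measurable h₂)
    (hχ0 : ∀ U, 0 ≤ χ₁ U) {C : ℝ} (hC₁ : ∀ U, χ₁ U * Real.exp (h₁ U) ≤ C)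
    (hC₂ : ∀ U, χ₂ U * Real.exp (h₂ U) ≤ C) {B : (s → G) → β → E} {S : Finset β}
    (hB : ∀ b ∈ S, StronglyMeasurable fun y => B y b) {R : ℝ} (hR : ∀ b ∈ S, ∀ y, ‖B y b‖ ≤ R) {σ τ : ℝ}
    (hσ : 0 ≤ σ) (hτ : 0 ≤ τ) {V : GaugeField P j G}
    (hne : fibreIntegral s (fun U => χ₁ U * Real.exp (h₁ U)) V ≠ 0) (hV : V ∈ pairDom s χ₁ χ₂ h₁ h₂ B S σ τ)
    (t : ℝ) {a : β → E} {A : ℝ} (hA : ∀ b ∈ S, ‖a b‖ ≤ A) :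
    |condMean s (fun U => χ₁ U * Real.exp (h₁ U)) (linDensity t S a (fibreReading s B)) V -
        condMean s (fun U => χ₂ U * Real.exp (h₂ U)) (linDensity t S a (fibreReading s B)) V|
      ≤ |t| * ((S.card : ℝ) * A * (σ * τ)) := by
  obtain ⟨hwin, ⟨K, hK⟩, hVg, hVF⟩ := hV
  refine abs_condMean_linDensity_pair_le s hC₁ hC₂ t hA (fun b hb => stronglyMeasurable_fibreReading s (hB b hb))
    (fun b hb U => hR b hb (onFibre s U)) fun b hb => ?_
  rw [condMeanField_fibreReading, condMeanField_fibreReading]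
  have h := norm_condMean_pair_sub_le_of_varianceBound s hχm hh₁ hh₂ hχ0 hC₁ hne hwin hK
    (hB b hb).aestronglyMeasurable (hR b hb) hVg (hVF b hb)
  rw [Real.sqrt_sq hσ, Real.sqrt_sq hτ, norm_sub_rev] at h
  exact h

/-- **ROUTE (P) UP TO EXTERIOR-ONLY WINDOW FACTORS.**  One term with laws `old = A₁·(ω·e^{h₁})`,
`ins = A₂·(ω·e^{h₂})`: a COMMON measurable fibre-reading window `ω ≥ 0`, measurable exponents, stripped laws `≤ C`,
FIBRE-INDEPENDENT window factors `A₁ ≥ 0` and `A₂ > 0` on the old live set (restrictions not reading the fibre),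
strongly measurable bounded bond inserts, `σ, τ ≥ 0`, and the old term's live set inside `pairDom s ω ω h₁ h₂ B S σ τ`
(whose window conjunct (WIN) is TRIVIAL — one window): `CondMeanGap s ins old (linDensity t S a (fibreReading s B))
(|t|·(|S|·A·(σ·τ)))`.  The exterior-only factors never enter. [folklore] -/
theorem condMeanGap_linDensity_of_pairVariance_factor [CompleteSpace E] (s : Finset (PBond P j))
    {ω h₁ h₂ A₁ A₂ : Density P j G} (hωm : Measurable ω) (hh₁ : Measurable h₁) (hh₂ : Measurable h₂)
    (hω0 : ∀ U, 0 ≤ ω U) {C : ℝ} (hC₁ : ∀ U, ω U * Real.exp (h₁ U) ≤ C) (hC₂ : ∀ U, ω U * Real.exp (h₂ U) ≤ C)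
    (hA₁ : FibreIndep s A₁) (hA₁0 : ∀ V, 0 ≤ A₁ V) (hA₂ : FibreIndep s A₂)
    (hA₂pos : ∀ V ∈ liveSet s (A₁ * fun U => ω U * Real.exp (h₁ U)), 0 < A₂ V)
    {B : (s → G) → β → E} {S : Finset β} (hB : ∀ b ∈ S, StronglyMeasurable fun y => B y b) {R : ℝ}
    (hR : ∀ b ∈ S, ∀ y, ‖B y b‖ ≤ R) {σ τ : ℝ} (hσ : 0 ≤ σ) (hτ : 0 ≤ τ)
    (hdom : liveSet s (A₁ * fun U => ω U * Real.exp (h₁ U)) ⊆ pairDom s ω ω h₁ h₂ B S σ τ) (t : ℝ) {a : β → E}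
    {A : ℝ} (hA : ∀ b ∈ S, ‖a b‖ ≤ A) :
    CondMeanGap s (A₂ * fun U => ω U * Real.exp (h₂ U)) (A₁ * fun U => ω U * Real.exp (h₁ U))
      (linDensity t S a (fibreReading s B)) (|t| * ((S.card : ℝ) * A * (σ * τ))) :=
  condMeanGap_of_fibreIndep_mul (hωm.mul (Real.measurable_exp.comp hh₁)) hA₁ hA₁0 hA₂ hA₂pos
    fun _ hV hne' => abs_condMean_linDensity_pair_le_of_mem_pairDom s hωm hh₁ hh₂ hω0 hC₁ hC₂ hB hR hσ hτ hne'
      (hdom hV) t hA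

/-- The same with the laws written as `χᵢ·e^{hᵢ}`, `χᵢ = Aᵢ·ω` (the shape of `T4CondMeanChannelInsert`). [folklore] -/
theorem condMeanGap_linDensity_of_pairVariance_factor' [CompleteSpace E] (s : Finset (PBond P j))
    {ω h₁ h₂ A₁ A₂ : Density P j G} (hωm : Measurable ω) (hh₁ : Measurable h₁) (hh₂ : Measurable h₂)
    (hω0 : ∀ U, 0 ≤ ω U) {C : ℝ} (hC₁ : ∀ U, ω U * Real.exp (h₁ U) ≤ C) (hC₂ : ∀ U, ω U * Real.exp (h₂ U) ≤ C)
    (hA₁ : FibreIndep s A₁) (hA₁0 : ∀ V, 0 ≤ A₁ V) (hA₂ : FibreIndep s A₂)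
    (hA₂pos : ∀ V ∈ liveSet s (fun U => A₁ U * ω U * Real.exp (h₁ U)), 0 < A₂ V)
    {B : (s → G) → β → E} {S : Finset β} (hB : ∀ b ∈ S, StronglyMeasurable fun y => B y b) {R : ℝ}
    (hR : ∀ b ∈ S, ∀ y, ‖B y b‖ ≤ R) {σ τ : ℝ} (hσ : 0 ≤ σ) (hτ : 0 ≤ τ)
    (hdom : liveSet s (fun U => A₁ U * ω U * Real.exp (h₁ U)) ⊆ pairDom s ω ω h₁ h₂ B S σ τ) (t : ℝ) {a : β → E}
    {A : ℝ} (hA : ∀ b ∈ S, ‖a b‖ ≤ A) :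
    CondMeanGap s (fun U => A₂ U * ω U * Real.exp (h₂ U)) (fun U => A₁ U * ω U * Real.exp (h₁ U))
      (linDensity t S a (fibreReading s B)) (|t| * ((S.card : ℝ) * A * (σ * τ))) := by
  have e₁ : (fun U => A₁ U * ω U * Real.exp (h₁ U)) = A₁ * fun U => ω U * Real.exp (h₁ U) :=
    funext fun U => mul_assoc _ _ _
  have e₂ : (fun U => A₂ U * ω U * Real.exp (h₂ U)) = A₂ * fun U => ω U * Real.exp (h₂ U) :=
    funext fun U => mul_assoc _ _ _
  rw [e₁] at hA₂pos hdom
  rw [e₁, e₂]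
  exact condMeanGap_linDensity_of_pairVariance_factor s hωm hh₁ hh₂ hω0 hC₁ hC₂ hA₁ hA₁0 hA₂ hA₂pos hB hR hσ hτ
    hdom t hA

/-- **THE CHART FORM.**  Exterior-only window factors `A₁ ≥ 0`, `A₂ > 0` (fibre-independent), a common fibre-reading
window `ω`, REAL bond inserts, moduli `λ > 0`, `b, L ≥ 0`, and PAIR-CHART DATA `T4PairResponseChart.PairChartAt s ω ω
h₁ h₂ B T λ b L V` at every old-live exterior (its window field is `fun _ => rfl`):
`CondMeanGap s ins old (linDensity t T a (fibreReading s B)) (|t|·(|T|·A·(b·L/λ)))`. [folklore] -/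
theorem condMeanGap_linDensity_of_pairCharts_factor (s : Finset (PBond P j)) {ω h₁ h₂ A₁ A₂ : Density P j G}
    (hωm : Measurable ω) (hh₁ : Measurable h₁) (hh₂ : Measurable h₂) (hω0 : ∀ U, 0 ≤ ω U) {C : ℝ}
    (hC₁ : ∀ U, ω U * Real.exp (h₁ U) ≤ C) (hC₂ : ∀ U, ω U * Real.exp (h₂ U) ≤ C) (hA₁ : FibreIndep s A₁)
    (hA₁0 : ∀ V, 0 ≤ A₁ V) (hA₂ : FibreIndep s A₂)
    (hA₂pos : ∀ V ∈ liveSet s (A₁ * fun U => ω U * Real.exp (h₁ U)), 0 < A₂ V)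
    {B : (s → G) → β → ℝ} {T : Finset β} (hB : ∀ b' ∈ T, StronglyMeasurable fun y => B y b') {R : ℝ}
    (hR : ∀ b' ∈ T, ∀ y, ‖B y b'‖ ≤ R) {lam b L : ℝ} (hlam : 0 < lam) (hb : 0 ≤ b) (hL : 0 ≤ L)
    (hd : ∀ V ∈ liveSet s (A₁ * fun U => ω U * Real.exp (h₁ U)), PairChartAt s ω ω h₁ h₂ B T lam b L V)
    (t : ℝ) {a : β → ℝ} {A : ℝ} (hA : ∀ b' ∈ T, ‖a b'‖ ≤ A) :
    CondMeanGap s (A₂ * fun U => ω U * Real.exp (h₂ U)) (A₁ * fun U => ω U * Real.exp (h₁ U))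
      (linDensity t T a (fibreReading s B)) (|t| * ((T.card : ℝ) * A * (b * L / lam))) := by
  have h := condMeanGap_linDensity_of_pairVariance_factor s hωm hh₁ hh₂ hω0 hC₁ hC₂ hA₁ hA₁0 hA₂ hA₂pos hB hR
    (div_nonneg hb (Real.sqrt_nonneg _)) (div_nonneg hL (Real.sqrt_nonneg _))
    (fun V hV => mem_pairDom_of_pairChartAt (hd V hV) hωm hh₁ hh₂ hω0 hC₁ hlam
      fun b' hb' => (hB b' hb').measurable) t hA
  have key : b / Real.sqrt lam * (L / Real.sqrt lam) = b * L / lam := by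
    rw [div_mul_div_comm, ← sq, Real.sq_sqrt hlam.le]
  rwa [key] at h

/-- **THE INCREMENT BOUND UP TO EXTERIOR-ONLY WINDOW FACTORS.**  Under the printed provisos for the actual laws
`old = A₁·(ω·e^{h₁})`, `ins = A₂·(ω·e^{h₂})` (common bound `C₀`), the data of
`condMeanGap_linDensity_of_pairVariance_factor`, a nonnegative bounded measurable weight `g` with a bounded measurable
fibre-independent reference `m`, and remainder bounds `q₁`, `q₂` of the linearisation on the supports:
`|termDefect s ins old g| ≤ (|t|·(|S|·A·(σ·τ)) + (q₁ + q₂))·∫dV old` —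
`T4CondMeanChannelInsert.condMeanGap_of_pairChannel` + `T4ObservableTelescope.abs_termDefect_le_of_condMeanGap` BY NAME.
[folklore] -/
theorem abs_termDefect_le_of_pairVariance_factor [CompleteSpace E] {s : Finset (PBond P j)}
    {ω h₁ h₂ A₁ A₂ : Density P j G} {C₀ : ℝ}
    (hP : TermProvisos s (A₂ * fun U => ω U * Real.exp (h₂ U)) (A₁ * fun U => ω U * Real.exp (h₁ U)) C₀)
    (hωm : Measurable ω) (hh₁ : Measurable h₁) (hh₂ : Measurable h₂) (hω0 : ∀ U, 0 ≤ ω U) {C : ℝ}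
    (hC₁ : ∀ U, ω U * Real.exp (h₁ U) ≤ C) (hC₂ : ∀ U, ω U * Real.exp (h₂ U) ≤ C) (hA₁ : FibreIndep s A₁)
    (hA₁0 : ∀ V, 0 ≤ A₁ V) (hA₂ : FibreIndep s A₂)
    (hA₂pos : ∀ V ∈ liveSet s (A₁ * fun U => ω U * Real.exp (h₁ U)), 0 < A₂ V) {g : Density P j G}
    (hg : Measurable g) (hg0 : ∀ U, 0 ≤ g U) {Bg : ℝ} (hgB : ∀ U, g U ≤ Bg) {m : Density P j G}
    (hmm : Measurable m) {Bm : ℝ} (hBm : ∀ U, |m U| ≤ Bm) (hmI : FibreIndep s m) (t : ℝ) {S : Finset β}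
    {a : β → E} {A : ℝ} (hA : ∀ b ∈ S, ‖a b‖ ≤ A) {B : (s → G) → β → E}
    (hB : ∀ b ∈ S, StronglyMeasurable fun y => B y b) {R : ℝ} (hR : ∀ b ∈ S, ∀ y, ‖B y b‖ ≤ R) {σ τ : ℝ}
    (hσ : 0 ≤ σ) (hτ : 0 ≤ τ)
    (hdom : liveSet s (A₁ * fun U => ω U * Real.exp (h₁ U)) ⊆ pairDom s ω ω h₁ h₂ B S σ τ) {q₁ q₂ : ℝ}
    (hq₁ : ∀ (V : GaugeField P j G) (y : s → G),
      (A₁ * fun U => ω U * Real.exp (h₁ U)) (updateFinset V s y) ≠ 0 →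
      |g (updateFinset V s y) - m V - linDensity t S a (fibreReading s B) (updateFinset V s y)| ≤ q₁)
    (hq₂ : ∀ V ∈ liveSet s (A₁ * fun U => ω U * Real.exp (h₁ U)), ∀ y : s → G,
      (A₂ * fun U => ω U * Real.exp (h₂ U)) (updateFinset V s y) ≠ 0 →
      |g (updateFinset V s y) - m V - linDensity t S a (fibreReading s B) (updateFinset V s y)| ≤ q₂) :
    |termDefect s (A₂ * fun U => ω U * Real.exp (h₂ U)) (A₁ * fun U => ω U * Real.exp (h₁ U)) g|
      ≤ (|t| * ((S.card : ℝ) * A * (σ * τ)) + (q₁ + q₂)) *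
        ∫ V, (A₁ * fun U => ω U * Real.exp (h₁ U)) V ∂fieldMeasure P j G :=
  abs_termDefect_le_of_condMeanGap hP hg hg0 hgB
    (condMeanGap_of_pairChannel hP hg hmm
      (measurable_linDensity t a fun b hb => stronglyMeasurable_fibreReading s (hB b hb))
      (fun U => by rw [abs_of_nonneg (hg0 U)]; exact hgB U) hBm
      (abs_linDensity_le hA fun b hb U => hR b hb (onFibre s U)) hmI
      (condMeanGap_linDensity_of_pairVariance_factor s hωm hh₁ hh₂ hω0 hC₁ hC₂ hA₁ hA₁0 hA₂ hA₂pos hB hR hσ hτ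
        hdom t hA)
      hq₁ hq₂)

end RouteP

end Literature.MathematicalPhysics.QuantumFieldTheory.Balaban1983to89.T4PairResponseWindow

end
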